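import Summits.Ventures.PercRepro.RankLevelSetRuleQSliceRhoPath
import Summits.Ventures.PercRepro.RankLevelSetRuleQSliceDiagRec

/-!
# PercRepro — THE UNIFORM BORDERLINE ON THE LARGE-`q` REGIME: `Φ(q+k, q) ≤ R̂(q, k, q−k+2)` FOR EVERY `k ≥ 23` AND EVERY
`q ≥ k(k−3)/2` (night-1, gen 20; dossier §31.9(c))

The conjecture of record (dossier §28.7) on the regime `q ≥ k(k−3)/2`, assembled from `phiK_le_rhat_border_of_tail`
(RankLevelSetRuleQSliceRhoPath), `border_tail_le` (RankLevelSetRuleQSliceDiagRec) and the decay `slice_diag_decay`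
(RankLevelSetRuleQSliceDiagRec): the tail is `≤ 2^{2k−3}·D_k(q) ≤ 2^{2k−3}·(i+1)!·2^i/q^i` (`i = ⌊(k−1)/2⌋`; for even `k`
through `D_k ≤ D_{k−1}`), and `2^{2k+i}·(i+1)! ≤ (k−1)(k−3)·(k(k−3)/2)^{i−1}` for `k ≥ 23` — the two numeric inequalities
`border_num_even` (`k = 2i+2`, `i ≥ 12`) and `border_num_odd` (`k = 2i+1`, `i ≥ 13`), each an induction on `i` with Bernoulli's inequality
(`(b/a)^{i−1} ≥ 1 + (i−1)(b−a)/a ≥ 2`) from a base case checked by `norm_num`.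
* **`border_large_even`** — `k = 2i + 2`, `i ≥ 11`, `(2i+1)(2i−2) ≤ 2m`: `Φ(q+k, q) ≤ R̂(q, k, m)`, `q = m + 2i`;
* **`border_large_odd`** — `k = 2i + 1`, `i ≥ 13`, `(2i)(2i−3) ≤ 2m`: the same with `q = m + 2i − 1`;
* **`phiK_le_rhat_border_large`** — every `k ≥ 23`, every `q ≥ k(k−3)/2`: `Φ(q+k, q) ≤ R̂(q, k, q − (k − 2))`.
Reading: Rule Q's equal split pays the borderline members `q − #P = k − 2` of every cell `(q+k, q)` with `q ≥ k(k−3)/2`, for every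
family `k ≥ 23` — the first kernel statement of the uniform borderline for infinitely many families; what remains of the
conjecture of record is the bottom regime `k − 2 ≤ q < k(k−3)/2` (every `k ≥ 11`) and `11 ≤ k ≤ 22` above it (finite gaps).
Axioms: standard.
-/

namespace PercRepro

open Finset

/-- Bernoulli: `(1 + x)^n ≥ 1 + n x` for `x ≥ 0` (naturals in `ℚ`). -/
lemma borderPath_bernoulli (x : ℚ) (hx : 0 ≤ x) (n : ℕ) : 1 + (n : ℚ) * x ≤ (1 + x) ^ n := by
  have := one_add_mul_le_pow (by linarith : (-2 : ℚ) ≤ x) n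
  linarith

/-- The even-`k` numeric inequality `N_even(i)`: `k = 2i + 2`, `2^{5i+4}·(i+1)! ≤ (2i+1)(2i−1)·((i+1)(2i−1))^{i−1}` for `i ≥ 11`. -/
lemma border_num_even : ∀ i : ℕ, 11 ≤ i →
    (2 : ℚ) ^ (5 * i + 4) * ((i + 1).factorial : ℚ) ≤ (2 * (i : ℚ) + 1) * (2 * (i : ℚ) - 1) * (((i : ℚ) + 1) * (2 * (i : ℚ) - 1)) ^ (i - 1) := by
  intro i hi
  induction i, hi using Nat.le_induction with
  | base => norm_num [Nat.factorial]
  | succ i hi ih =>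
    -- the step: RHS(i+1)/RHS(i) ≥ (i+2)(2i+1)·(2i+3)/(2i−1)·(1 + (i−1)·(4i+3)/((i+1)(2i−1))) ≥ 32 (i+2) = LHS(i+1)/LHS(i)
    have hi' : (11 : ℚ) ≤ i := by exact_mod_cast hi
    set a := ((i : ℚ) + 1) * (2 * (i : ℚ) - 1) with ha
    set b := ((i : ℚ) + 2) * (2 * (i : ℚ) + 1) with hb
    have ha0 : 0 < a := by rw [ha]; nlinarith
    have hab : a ≤ b := by rw [ha, hb]; nlinarith
    -- b^i ≥ a^(i-1) · b · (1 + (i-1)·(b-a)/a)   (Bernoulli on (b/a)^(i-1))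
    have hx0 : 0 ≤ (b - a) / a := div_nonneg (by linarith) ha0.le
    have hbern := borderPath_bernoulli ((b - a) / a) hx0 (i - 1)
    have hba : 1 + (b - a) / a = b / a := by field_simp; ring
    rw [hba] at hbern
    have hpow : b ^ i = a ^ (i - 1) * (b / a) ^ (i - 1) * b := by
      rw [div_pow, ← mul_div_assoc, mul_comm (a ^ (i - 1)), mul_div_assoc, div_self (pow_ne_zero _ ha0.ne'), mul_one]
      rw [← pow_succ]; congr 1; omega
    have hi1 : ((i - 1 : ℕ) : ℚ) = (i : ℚ) - 1 := by push_cast [Nat.cast_sub (by omega : 1 ≤ i)]; ring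
    rw [hi1] at hbern
    -- assemble: (b/a)^(i-1) ≥ 1 + (i-1)(b-a)/a ≥ 2, and (2i+3)(2i+1)·2b ≥ (2i+1)(2i-1)·32(i+2) for i ≥ 6
    have hfrac : (1 : ℚ) ≤ ((i : ℚ) - 1) * ((b - a) / a) := by
      rw [← sub_nonneg]
      have : ((i : ℚ) - 1) * ((b - a) / a) - 1 = (((i : ℚ) - 1) * (b - a) - a) / a := by field_simp
      rw [this]
      apply div_nonneg _ ha0.le
      rw [hb, ha]; nlinarith
    have hap : 0 < a ^ (i - 1) := by positivity
    have hb0 : 0 < b := by rw [hb]; nlinarith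
    have h1 : a ^ (i - 1) * 2 ≤ a ^ (i - 1) * (b / a) ^ (i - 1) :=
      mul_le_mul_of_nonneg_left (by linarith [hbern, hfrac]) hap.le
    have hscal : (2 * (i : ℚ) + 1) * (2 * (i : ℚ) - 1) * (32 * ((i : ℚ) + 2))
        ≤ (2 * ((i : ℚ) + 1) + 1) * (2 * ((i : ℚ) + 1) - 1) * (2 * b) := by
      rw [hb]
      have hq : (0 : ℚ) ≤ 4 * (i : ℚ) ^ 2 - 24 * i + 19 := by nlinarith
      have e : (2 * ((i : ℚ) + 1) + 1) * (2 * ((i : ℚ) + 1) - 1) * (2 * (((i : ℚ) + 2) * (2 * (i : ℚ) + 1)))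
          - (2 * (i : ℚ) + 1) * (2 * (i : ℚ) - 1) * (32 * ((i : ℚ) + 2))
          = 2 * ((i : ℚ) + 2) * (2 * (i : ℚ) + 1) * (4 * (i : ℚ) ^ 2 - 24 * i + 19) := by ring
      have : (0 : ℚ) ≤ 2 * ((i : ℚ) + 2) * (2 * (i : ℚ) + 1) * (4 * (i : ℚ) ^ 2 - 24 * i + 19) :=
        mul_nonneg (by positivity) hq
      linarith [e, this]
    have hR : (2 * (i : ℚ) + 1) * (2 * (i : ℚ) - 1) * a ^ (i - 1) * (32 * ((i : ℚ) + 2))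
        ≤ (2 * ((i : ℚ) + 1) + 1) * (2 * ((i : ℚ) + 1) - 1) * b ^ i := by
      rw [hpow]
      have h2 := mul_le_mul_of_nonneg_left hscal hap.le
      have h3 : (2 * ((i : ℚ) + 1) + 1) * (2 * ((i : ℚ) + 1) - 1) * (a ^ (i - 1) * 2 * b)
          ≤ (2 * ((i : ℚ) + 1) + 1) * (2 * ((i : ℚ) + 1) - 1) * (a ^ (i - 1) * (b / a) ^ (i - 1) * b) := by
        apply mul_le_mul_of_nonneg_left _ (by nlinarith)
        exact mul_le_mul_of_nonneg_right h1 hb0.le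
      nlinarith [h2, h3]
    have hL : (2 : ℚ) ^ (5 * (i + 1) + 4) * ((i + 1 + 1).factorial : ℚ)
        = (2 : ℚ) ^ (5 * i + 4) * ((i + 1).factorial : ℚ) * (32 * ((i : ℚ) + 2)) := by
      rw [Nat.factorial_succ, show 5 * (i + 1) + 4 = 5 * i + 4 + 5 by ring, pow_add]; push_cast; ring
    rw [hL, show i + 1 - 1 = i by omega]
    push_cast
    rw [show ((i : ℚ) + 1 + 1) * (2 * ((i : ℚ) + 1) - 1) = b by rw [hb]; ring]
    have := mul_le_mul_of_nonneg_right ih (by positivity : (0 : ℚ) ≤ 32 * ((i : ℚ) + 2))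
    calc (2 : ℚ) ^ (5 * i + 4) * ((i + 1).factorial : ℚ) * (32 * ((i : ℚ) + 2))
        ≤ (2 * (i : ℚ) + 1) * (2 * (i : ℚ) - 1) * a ^ (i - 1) * (32 * ((i : ℚ) + 2)) := this
      _ ≤ (2 * ((i : ℚ) + 1) + 1) * (2 * ((i : ℚ) + 1) - 1) * b ^ i := hR

/-- The odd-`k` numeric inequality `N_odd(i)`: `k = 2i + 1`, `2^{5i+2}·(i+1)! ≤ 4i(i−1)·((2i+1)(i−1))^{i−1}` for `i ≥ 11`. -/
lemma border_num_odd : ∀ i : ℕ, 11 ≤ i →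
    (2 : ℚ) ^ (5 * i + 2) * ((i + 1).factorial : ℚ) ≤ 4 * (i : ℚ) * ((i : ℚ) - 1) * ((2 * (i : ℚ) + 1) * ((i : ℚ) - 1)) ^ (i - 1) := by
  intro i hi
  induction i, hi using Nat.le_induction with
  | base => norm_num [Nat.factorial]
  | succ i hi ih =>
    have hi' : (11 : ℚ) ≤ i := by exact_mod_cast hi
    set a := (2 * (i : ℚ) + 1) * ((i : ℚ) - 1) with ha
    set b := (2 * (i : ℚ) + 3) * (i : ℚ) with hb
    have ha0 : 0 < a := by rw [ha]; nlinarith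
    have hab : a ≤ b := by rw [ha, hb]; nlinarith
    have hx0 : 0 ≤ (b - a) / a := div_nonneg (by linarith) ha0.le
    have hbern := borderPath_bernoulli ((b - a) / a) hx0 (i - 1)
    have hba : 1 + (b - a) / a = b / a := by field_simp; ring
    rw [hba] at hbern
    have hpow : b ^ i = a ^ (i - 1) * (b / a) ^ (i - 1) * b := by
      rw [div_pow, ← mul_div_assoc, mul_comm (a ^ (i - 1)), mul_div_assoc, div_self (pow_ne_zero _ ha0.ne'), mul_one]
      rw [← pow_succ]; congr 1; omega
    have hi1 : ((i - 1 : ℕ) : ℚ) = (i : ℚ) - 1 := by push_cast [Nat.cast_sub (by omega : 1 ≤ i)]; ring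
    rw [hi1] at hbern
    have hfrac : (1 : ℚ) ≤ ((i : ℚ) - 1) * ((b - a) / a) := by
      rw [← sub_nonneg]
      have : ((i : ℚ) - 1) * ((b - a) / a) - 1 = (((i : ℚ) - 1) * (b - a) - a) / a := by field_simp
      rw [this]
      apply div_nonneg _ ha0.le
      rw [hb, ha]; nlinarith
    have hap : 0 < a ^ (i - 1) := by positivity
    have hb0 : 0 < b := by rw [hb]; nlinarith
    have h1 : a ^ (i - 1) * 2 ≤ a ^ (i - 1) * (b / a) ^ (i - 1) :=
      mul_le_mul_of_nonneg_left (by linarith [hbern, hfrac]) hap.le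
    -- scalar: 4i(i−1)·32(i+2) ≤ 4(i+1)i·2b, i.e. 16(i−1)(i+2) ≤ (i+1)(2i+3)i … (4i³ − 22i² − 26i + 64 ≥ 0 for i ≥ 7)
    have hscal : 4 * (i : ℚ) * ((i : ℚ) - 1) * (32 * ((i : ℚ) + 2))
        ≤ 4 * ((i : ℚ) + 1) * (((i : ℚ) + 1) - 1) * (2 * b) := by
      rw [hb]
      have hq : (0 : ℚ) ≤ 4 * (i : ℚ) ^ 3 - 22 * (i : ℚ) ^ 2 - 26 * i + 64 := by nlinarith
      have e : 4 * ((i : ℚ) + 1) * (((i : ℚ) + 1) - 1) * (2 * ((2 * (i : ℚ) + 3) * (i : ℚ)))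
          - 4 * (i : ℚ) * ((i : ℚ) - 1) * (32 * ((i : ℚ) + 2))
          = 4 * (i : ℚ) * (4 * (i : ℚ) ^ 3 - 22 * (i : ℚ) ^ 2 - 26 * i + 64) := by ring
      have : (0 : ℚ) ≤ 4 * (i : ℚ) * (4 * (i : ℚ) ^ 3 - 22 * (i : ℚ) ^ 2 - 26 * i + 64) :=
        mul_nonneg (by positivity) hq
      linarith [e, this]
    have hR : 4 * (i : ℚ) * ((i : ℚ) - 1) * a ^ (i - 1) * (32 * ((i : ℚ) + 2))
        ≤ 4 * ((i : ℚ) + 1) * (((i : ℚ) + 1) - 1) * b ^ i := by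
      rw [hpow]
      have h2 := mul_le_mul_of_nonneg_left hscal hap.le
      have h3 : 4 * ((i : ℚ) + 1) * (((i : ℚ) + 1) - 1) * (a ^ (i - 1) * 2 * b)
          ≤ 4 * ((i : ℚ) + 1) * (((i : ℚ) + 1) - 1) * (a ^ (i - 1) * (b / a) ^ (i - 1) * b) := by
        apply mul_le_mul_of_nonneg_left _ (by nlinarith)
        exact mul_le_mul_of_nonneg_right h1 hb0.le
      nlinarith [h2, h3]
    have hL : (2 : ℚ) ^ (5 * (i + 1) + 2) * ((i + 1 + 1).factorial : ℚ)
        = (2 : ℚ) ^ (5 * i + 2) * ((i + 1).factorial : ℚ) * (32 * ((i : ℚ) + 2)) := by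
      rw [Nat.factorial_succ, show 5 * (i + 1) + 2 = 5 * i + 2 + 5 by ring, pow_add]; push_cast; ring
    rw [hL, show i + 1 - 1 = i by omega]
    push_cast
    rw [show (2 * ((i : ℚ) + 1) + 1) * (((i : ℚ) + 1) - 1) = b by rw [hb]; ring]
    have := mul_le_mul_of_nonneg_right ih (by positivity : (0 : ℚ) ≤ 32 * ((i : ℚ) + 2))
    calc (2 : ℚ) ^ (5 * i + 2) * ((i + 1).factorial : ℚ) * (32 * ((i : ℚ) + 2))
        ≤ 4 * (i : ℚ) * ((i : ℚ) - 1) * a ^ (i - 1) * (32 * ((i : ℚ) + 2)) := this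
      _ ≤ 4 * ((i : ℚ) + 1) * (((i : ℚ) + 1) - 1) * b ^ i := hR

/-- **The even-`k` borderline from one numeric inequality** (`k = 2i + 2`, `i ≥ 1`, `q = m + 2i`, `(2i+1)(2i−2) ≤ 2m`): if
`2^{4i+1}·(i+1)!·2^i·4(q+1) ≤ (2i+1)(2i−1)·q^i` then `Φ(q+k, q) ≤ R̂(q, k, m)`. (Per-`k` thresholds for `11 ≤ k ≤ 22` go through this.) -/
theorem border_even_of_key (i m : ℕ) (hi : 1 ≤ i) (hm : (2 * i + 1) * (2 * i - 2) ≤ 2 * m)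
    (hkey : (2 : ℚ) ^ (4 * i + 1) * (((i + 1).factorial : ℚ) * 2 ^ i) * (4 * (((m + 2 * i : ℕ) : ℚ) + 1))
      ≤ (2 * (i : ℚ) + 1) * (2 * (i : ℚ) - 1) * ((m + 2 * i : ℕ) : ℚ) ^ i) :
    phiK (m + 2 * i + (2 * i + 2)) (m + 2 * i) ≤ rhat (m + 2 * i) (2 * i + 2) m := by
  refine phiK_le_rhat_border_of_tail m (2 * i) (by omega) hm ?_
  have hq1 : 1 ≤ m + 2 * i := by omega
  have hT1 := border_tail_le m (2 * i)
  have h21 := slice_le_of_le (m + 2 * i) (m + 2 * i) (2 * i + 1) (2 * i + 2) (by omega)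
  have hd := (slice_diag_decay (m + 2 * i) hq1 i).1
  set Q := ((m + 2 * i : ℕ) : ℚ) with hQdef
  have hQ1 : (1 : ℚ) ≤ Q := by rw [hQdef]; exact_mod_cast hq1
  set D1 := ∑ a ∈ range (m + 2 * i + 1), ((m + 2 * i).choose a : ℚ)
      / ((m + 2 * i + (2 * i + 1) + a).choose (a + (2 * i + 1)) : ℚ) with hD1
  set D2 := ∑ a ∈ range (m + 2 * i + 1), ((m + 2 * i).choose a : ℚ)
      / ((m + 2 * i + (2 * i + 2) + a).choose (a + (2 * i + 2)) : ℚ) with hD2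
  have hD10 : 0 ≤ D1 := Finset.sum_nonneg (fun a _ => by positivity)
  set F := ((i + 1).factorial : ℚ) * 2 ^ i with hF
  have hF0 : 0 < F := by rw [hF]; positivity
  -- T ≤ 2^{4i+2} D1, D1 Q^i ≤ F
  have hT2 : ∑ j ∈ range (2 * i + 1), ((2 * (2 * i) + 2).choose (2 * i + 2 + j) : ℚ)
      * ∑ a ∈ range (m + 1), (m.choose a : ℚ) / ((m + 2 * i + (2 * i + 2 + j) + a).choose (a + (2 * i + 2 + j)) : ℚ)
      ≤ (2 : ℚ) ^ (4 * i + 1) * D1 := by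
    calc _ ≤ (2 : ℚ) ^ (2 * (2 * i) + 1) * D2 := hT1
      _ ≤ (2 : ℚ) ^ (2 * (2 * i) + 1) * D1 := mul_le_mul_of_nonneg_left h21 (by positivity)
      _ = (2 : ℚ) ^ (4 * i + 1) * D1 := by rw [show 2 * (2 * i) + 1 = 4 * i + 1 by ring]
  refine hT2.trans ?_
  have ecast : (((2 * i : ℕ) : ℚ) + 1) * (((2 * i : ℕ) : ℚ) - 1) / (4 * ((m : ℚ) + ((2 * i : ℕ) : ℚ) + 1))
      = (2 * (i : ℚ) + 1) * (2 * (i : ℚ) - 1) / (4 * (Q + 1)) := by rw [hQdef]; push_cast; ring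
  rw [ecast]
  -- 2^{4i+2} D1 ≤ (2i+1)(2i−1)/(4(Q+1)):  D1 ≤ F / Q^i, and 2^{4i+2} F · 4(Q+1) ≤ (2i+1)(2i−1) Q^i
  have hQi : (0 : ℚ) < Q ^ i := by positivity
  have hD1le : D1 ≤ F / Q ^ i := by rw [le_div_iff₀ hQi]; exact hd
  have hkey' : (2 : ℚ) ^ (4 * i + 1) * F * (4 * (Q + 1)) ≤ (2 * (i : ℚ) + 1) * (2 * (i : ℚ) - 1) * Q ^ i := by
    rw [hF, hQdef]; exact hkey
  calc (2 : ℚ) ^ (4 * i + 1) * D1 ≤ (2 : ℚ) ^ (4 * i + 1) * (F / Q ^ i) := mul_le_mul_of_nonneg_left hD1le (by positivity)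
    _ = (2 : ℚ) ^ (4 * i + 1) * F / Q ^ i := by ring
    _ ≤ (2 * (i : ℚ) + 1) * (2 * (i : ℚ) - 1) / (4 * (Q + 1)) := by
        rw [div_le_div_iff₀ hQi (by positivity)]
        linarith [hkey']

/-- **THE UNIFORM BORDERLINE FOR EVEN `k = 2i + 2 ≥ 24` ON `q ≥ k(k−3)/2`**: `Φ(q+k, q) ≤ R̂(q, k, q−k+2)`
(`q = m + 2i`, `m = q − k + 2`, `(2i+1)(2i−2) ≤ 2m`, i.e. `q ≥ (i+1)(2i−1) = k(k−3)/2`) — `border_even_of_key` with `border_num_even`. -/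
theorem border_large_even (i m : ℕ) (hi : 11 ≤ i) (hm : (2 * i + 1) * (2 * i - 2) ≤ 2 * m) :
    phiK (m + 2 * i + (2 * i + 2)) (m + 2 * i) ≤ rhat (m + 2 * i) (2 * i + 2) m := by
  refine border_even_of_key i m (by omega) hm ?_
  have hQ : ((i : ℚ) + 1) * (2 * (i : ℚ) - 1) ≤ ((m + 2 * i : ℕ) : ℚ) := by
    have h' : (2 * i + 1) * (2 * i - 2) + 2 * (2 * i) ≤ 2 * (m + 2 * i) := by omega
    have hc : (((2 * i + 1) * (2 * i - 2) + 2 * (2 * i) : ℕ) : ℚ) = 2 * (((i : ℚ) + 1) * (2 * (i : ℚ) - 1)) := by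
      push_cast [Nat.cast_sub (by omega : 2 ≤ 2 * i)]; ring
    have : (((2 * i + 1) * (2 * i - 2) + 2 * (2 * i) : ℕ) : ℚ) ≤ ((2 * (m + 2 * i) : ℕ) : ℚ) := by exact_mod_cast h'
    rw [hc] at this; push_cast at this ⊢; linarith
  set Q := ((m + 2 * i : ℕ) : ℚ) with hQdef
  have hQ1 : (1 : ℚ) ≤ Q := by rw [hQdef]; exact_mod_cast (by omega : 1 ≤ m + 2 * i)
  have hnum := border_num_even i hi
  have hi' : (11 : ℚ) ≤ i := by exact_mod_cast hi
  have hpw : (((i : ℚ) + 1) * (2 * (i : ℚ) - 1)) ^ (i - 1) ≤ Q ^ (i - 1) :=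
    pow_le_pow_left₀ (by nlinarith) hQ (i - 1)
  have hQi' : Q ^ i = Q ^ (i - 1) * Q := by rw [← pow_succ]; congr 1; omega
  have e1 : (2 : ℚ) ^ (4 * i + 1) * (((i + 1).factorial : ℚ) * 2 ^ i) * (4 * (Q + 1))
      ≤ (2 : ℚ) ^ (5 * i + 4) * ((i + 1).factorial : ℚ) * Q := by
    have : (4 : ℚ) * (Q + 1) ≤ 8 * Q := by linarith
    calc (2 : ℚ) ^ (4 * i + 1) * (((i + 1).factorial : ℚ) * 2 ^ i) * (4 * (Q + 1))
        ≤ (2 : ℚ) ^ (4 * i + 1) * (((i + 1).factorial : ℚ) * 2 ^ i) * (8 * Q) :=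
          mul_le_mul_of_nonneg_left this (by positivity)
      _ = (2 : ℚ) ^ (5 * i + 4) * ((i + 1).factorial : ℚ) * Q := by
          rw [show (5 : ℕ) * i + 4 = 4 * i + 1 + i + 3 by ring, pow_add, pow_add]; ring
  have e2 : (2 : ℚ) ^ (5 * i + 4) * ((i + 1).factorial : ℚ) * Q
      ≤ (2 * (i : ℚ) + 1) * (2 * (i : ℚ) - 1) * (((i : ℚ) + 1) * (2 * (i : ℚ) - 1)) ^ (i - 1) * Q :=
    mul_le_mul_of_nonneg_right hnum (by linarith)
  have e3 : (2 * (i : ℚ) + 1) * (2 * (i : ℚ) - 1) * (((i : ℚ) + 1) * (2 * (i : ℚ) - 1)) ^ (i - 1) * Q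
      ≤ (2 * (i : ℚ) + 1) * (2 * (i : ℚ) - 1) * Q ^ (i - 1) * Q := by
    have hc : (0 : ℚ) ≤ (2 * (i : ℚ) + 1) * (2 * (i : ℚ) - 1) := by nlinarith
    exact mul_le_mul_of_nonneg_right (mul_le_mul_of_nonneg_left hpw hc) (by linarith)
  rw [hQi']
  linarith [e1, e2, e3]

/-- **The odd-`k` borderline from one numeric inequality** (`k = 2j + 3`, `j ≥ 1`, `q = m + 2j + 1`, `(2j+2)(2j−1) ≤ 2m`): if
`2^{4j+3}·(j+2)!·2^{j+1}·4(q+1) ≤ 4(j+1)j·q^{j+1}` then `Φ(q+k, q) ≤ R̂(q, k, m)`. -/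
theorem border_odd_of_key (j m : ℕ) (hj : 1 ≤ j) (hm : (2 * j + 1 + 1) * (2 * j + 1 - 2) ≤ 2 * m)
    (hkey : (2 : ℚ) ^ (4 * j + 3) * (((j + 1 + 1).factorial : ℚ) * 2 ^ (j + 1)) * (4 * (((m + (2 * j + 1) : ℕ) : ℚ) + 1))
      ≤ 4 * ((j : ℚ) + 1) * (j : ℚ) * ((m + (2 * j + 1) : ℕ) : ℚ) ^ (j + 1)) :
    phiK (m + (2 * j + 1) + (2 * j + 1 + 2)) (m + (2 * j + 1)) ≤ rhat (m + (2 * j + 1)) (2 * j + 1 + 2) m := by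
  refine phiK_le_rhat_border_of_tail m (2 * j + 1) (by omega) hm ?_
  have hq1 : 1 ≤ m + (2 * j + 1) := by omega
  have hT1 := border_tail_le m (2 * j + 1)
  have hd := (slice_diag_decay (m + (2 * j + 1)) hq1 (j + 1)).1
  rw [show 2 * (j + 1) + 1 = 2 * j + 1 + 2 by ring] at hd
  set Q := ((m + (2 * j + 1) : ℕ) : ℚ) with hQdef
  have hQ1 : (1 : ℚ) ≤ Q := by rw [hQdef]; exact_mod_cast hq1
  set D1 := ∑ a ∈ range (m + (2 * j + 1) + 1), ((m + (2 * j + 1)).choose a : ℚ)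
      / ((m + (2 * j + 1) + (2 * j + 1 + 2) + a).choose (a + (2 * j + 1 + 2)) : ℚ) with hD1
  have hD10 : 0 ≤ D1 := Finset.sum_nonneg (fun a _ => by positivity)
  set F := ((j + 1 + 1).factorial : ℚ) * 2 ^ (j + 1) with hF
  have hF0 : 0 < F := by rw [hF]; positivity
  have hT2 : ∑ i ∈ range (2 * j + 1 + 1), ((2 * (2 * j + 1) + 2).choose (2 * j + 1 + 2 + i) : ℚ)
      * ∑ a ∈ range (m + 1), (m.choose a : ℚ)
        / ((m + (2 * j + 1) + (2 * j + 1 + 2 + i) + a).choose (a + (2 * j + 1 + 2 + i)) : ℚ)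
      ≤ (2 : ℚ) ^ (4 * j + 3) * D1 := by
    calc _ ≤ (2 : ℚ) ^ (2 * (2 * j + 1) + 1) * D1 := hT1
      _ = (2 : ℚ) ^ (4 * j + 3) * D1 := by rw [show 2 * (2 * j + 1) + 1 = 4 * j + 3 by ring]
  refine hT2.trans ?_
  have ecast : (((2 * j + 1 : ℕ) : ℚ) + 1) * (((2 * j + 1 : ℕ) : ℚ) - 1) / (4 * ((m : ℚ) + ((2 * j + 1 : ℕ) : ℚ) + 1))
      = (4 * ((j : ℚ) + 1) * (j : ℚ)) / (4 * (Q + 1)) := by rw [hQdef]; push_cast; ring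
  rw [ecast]
  have hQi : (0 : ℚ) < Q ^ (j + 1) := by positivity
  have hD1le : D1 ≤ F / Q ^ (j + 1) := by rw [le_div_iff₀ hQi]; exact hd
  have hkey' : (2 : ℚ) ^ (4 * j + 3) * F * (4 * (Q + 1)) ≤ 4 * ((j : ℚ) + 1) * (j : ℚ) * Q ^ (j + 1) := by
    rw [hF, hQdef]; exact hkey
  calc (2 : ℚ) ^ (4 * j + 3) * D1 ≤ (2 : ℚ) ^ (4 * j + 3) * (F / Q ^ (j + 1)) :=
        mul_le_mul_of_nonneg_left hD1le (by positivity)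
    _ = (2 : ℚ) ^ (4 * j + 3) * F / Q ^ (j + 1) := by ring
    _ ≤ (4 * ((j : ℚ) + 1) * (j : ℚ)) / (4 * (Q + 1)) := by
        rw [div_le_div_iff₀ hQi (by positivity)]
        linarith [hkey']

/-- **THE UNIFORM BORDERLINE FOR ODD `k = 2j + 3 ≥ 23` ON `q ≥ k(k−3)/2`**: `Φ(q+k, q) ≤ R̂(q, k, q−k+2)`
(`q = m + 2j + 1`, `m = q − k + 2`, `(2j+2)(2j−1) ≤ 2m`, i.e. `q ≥ (2j+3)j = k(k−3)/2`) — `border_odd_of_key` with `border_num_odd`. -/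
theorem border_large_odd (j m : ℕ) (hj : 10 ≤ j) (hm : (2 * j + 1 + 1) * (2 * j + 1 - 2) ≤ 2 * m) :
    phiK (m + (2 * j + 1) + (2 * j + 1 + 2)) (m + (2 * j + 1)) ≤ rhat (m + (2 * j + 1)) (2 * j + 1 + 2) m := by
  refine border_odd_of_key j m (by omega) hm ?_
  have hQ : (2 * (j : ℚ) + 3) * (j : ℚ) ≤ ((m + (2 * j + 1) : ℕ) : ℚ) := by
    have h' : (2 * j + 1 + 1) * (2 * j + 1 - 2) + 2 * (2 * j + 1) ≤ 2 * (m + (2 * j + 1)) := by omega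
    have hc : (((2 * j + 1 + 1) * (2 * j + 1 - 2) + 2 * (2 * j + 1) : ℕ) : ℚ) = 2 * ((2 * (j : ℚ) + 3) * (j : ℚ)) := by
      rw [show 2 * j + 1 - 2 = 2 * j - 1 by omega]
      push_cast [Nat.cast_sub (by omega : 1 ≤ 2 * j)]; ring
    have : (((2 * j + 1 + 1) * (2 * j + 1 - 2) + 2 * (2 * j + 1) : ℕ) : ℚ) ≤ ((2 * (m + (2 * j + 1)) : ℕ) : ℚ) := by
      exact_mod_cast h'
    rw [hc] at this; push_cast at this ⊢; linarith
  set Q := ((m + (2 * j + 1) : ℕ) : ℚ) with hQdef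
  have hQ1 : (1 : ℚ) ≤ Q := by rw [hQdef]; exact_mod_cast (by omega : 1 ≤ m + (2 * j + 1))
  have hnum := border_num_odd (j + 1) (by omega)
  have hpw : ((2 * (j : ℚ) + 3) * (j : ℚ)) ^ j ≤ Q ^ j := pow_le_pow_left₀ (by positivity) hQ j
  have e1 : (2 : ℚ) ^ (4 * j + 3) * (((j + 1 + 1).factorial : ℚ) * 2 ^ (j + 1)) * (4 * (Q + 1))
      ≤ (2 : ℚ) ^ (5 * (j + 1) + 2) * ((j + 1 + 1).factorial : ℚ) * Q := by
    have : (4 : ℚ) * (Q + 1) ≤ 8 * Q := by linarith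
    calc (2 : ℚ) ^ (4 * j + 3) * (((j + 1 + 1).factorial : ℚ) * 2 ^ (j + 1)) * (4 * (Q + 1))
        ≤ (2 : ℚ) ^ (4 * j + 3) * (((j + 1 + 1).factorial : ℚ) * 2 ^ (j + 1)) * (8 * Q) :=
          mul_le_mul_of_nonneg_left this (by positivity)
      _ = (2 : ℚ) ^ (5 * (j + 1) + 2) * ((j + 1 + 1).factorial : ℚ) * Q := by
          rw [show (5 : ℕ) * (j + 1) + 2 = 4 * j + 3 + (j + 1) + 3 by ring, pow_add, pow_add]; ring
  have hcast : 4 * ((j + 1 : ℕ) : ℚ) * (((j + 1 : ℕ) : ℚ) - 1) * ((2 * ((j + 1 : ℕ) : ℚ) + 1) * (((j + 1 : ℕ) : ℚ) - 1)) ^ (j + 1 - 1)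
      = 4 * ((j : ℚ) + 1) * (j : ℚ) * ((2 * (j : ℚ) + 3) * (j : ℚ)) ^ j := by
    rw [show j + 1 - 1 = j by omega]; push_cast; ring
  rw [hcast] at hnum
  have e2 : (2 : ℚ) ^ (5 * (j + 1) + 2) * ((j + 1 + 1).factorial : ℚ) * Q
      ≤ 4 * ((j : ℚ) + 1) * (j : ℚ) * ((2 * (j : ℚ) + 3) * (j : ℚ)) ^ j * Q :=
    mul_le_mul_of_nonneg_right hnum (by linarith)
  have e3 : 4 * ((j : ℚ) + 1) * (j : ℚ) * ((2 * (j : ℚ) + 3) * (j : ℚ)) ^ j * Q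
      ≤ 4 * ((j : ℚ) + 1) * (j : ℚ) * Q ^ j * Q := by
    have hc : (0 : ℚ) ≤ 4 * ((j : ℚ) + 1) * (j : ℚ) := by positivity
    exact mul_le_mul_of_nonneg_right (mul_le_mul_of_nonneg_left hpw hc) (by linarith)
  rw [show Q ^ (j + 1) = Q ^ j * Q from pow_succ Q j]
  linarith [e1, e2, e3]

/-- **THE UNIFORM BORDERLINE ON THE LARGE-`q` REGIME**: for every `k ≥ 23` and every `q ≥ k(k−3)/2`,
`Φ(q+k, q) ≤ R̂(q, k, q − (k − 2))` — Rule Q's equal split pays the borderline members of every such cell. -/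
theorem phiK_le_rhat_border_large (k q : ℕ) (hk : 23 ≤ k) (hq : k * (k - 3) ≤ 2 * q) :
    phiK (q + k) q ≤ rhat q k (q - (k - 2)) := by
  rcases Nat.even_or_odd k with ⟨l, hl⟩ | ⟨l, hl⟩
  · -- k = 2i + 2 with i = l − 1 ≥ 12
    obtain ⟨i, rfl⟩ : ∃ i, l = i + 1 := ⟨l - 1, by omega⟩
    have hk' : k = 2 * i + 2 := by omega
    subst hk'
    have hqi : 2 * i ≤ q := by
      have h := Nat.mul_le_mul (show 4 ≤ 2 * i + 2 by omega) (show i ≤ 2 * i + 2 - 3 by omega)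
      omega
    obtain ⟨m, rfl⟩ : ∃ m, q = m + 2 * i := ⟨q - 2 * i, by omega⟩
    rw [show m + 2 * i - (2 * i + 2 - 2) = m by omega]
    exact border_large_even i m (by omega) (by
      have h3 : 3 ≤ 2 * i + 2 := by omega
      have h2 : 2 ≤ 2 * i := by omega
      zify [h3, h2] at hq ⊢
      nlinarith [hq])
  · -- k = 2j + 3 with j ≥ 12
    obtain ⟨j, rfl⟩ : ∃ j, l = j + 1 := ⟨l - 1, by omega⟩
    have hk' : k = 2 * j + 1 + 2 := by omega
    subst hk'
    have hqj : 2 * j + 1 ≤ q := by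
      have h := Nat.mul_le_mul (show 3 ≤ 2 * j + 1 + 2 by omega) (show 2 * j ≤ 2 * j + 1 + 2 - 3 by omega)
      omega
    obtain ⟨m, rfl⟩ : ∃ m, q = m + (2 * j + 1) := ⟨q - (2 * j + 1), by omega⟩
    rw [show m + (2 * j + 1) - (2 * j + 1 + 2 - 2) = m by omega]
    exact border_large_odd j m (by omega) (by
      have h3 : 3 ≤ 2 * j + 1 + 2 := by omega
      have h2 : 2 ≤ 2 * j + 1 := by omega
      zify [h3, h2] at hq ⊢
      nlinarith [hq])

end PercRepro
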